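import Summits.ResolutionOfSingularities.ResolutionOfSingularities.Theorems.PurelyInseparableDim4Target
import Summits.ResolutionOfSingularities.ResolutionOfSingularities.Theorems.PurelyInseparableDim4IsoSpineTheorem
import Summits.ResolutionOfSingularities.ResolutionOfSingularities.Theorems.PurelyInseparableDim4Perm2BoundOrigin
import Mathlib.Algebra.MvPolynomial.Supported
import HarnessLib

/-!
# [OURS · res-dim4-pi · F4-C] COMPONENT THREADS, part 1 — the transversal dictionary (LEMMA T1, subset form)
  and TRANSVERSAL-THREAD FINITENESS

Cell `res-dim4-pi` (D-0157 DOOR 2, wave 2).  TYPED AND PROVED by `res-dim4-idea-2` g2 (CARD I-2-6 «COMPONENT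
THREADS — transversal Newton polyhedra» 76c08d904cb1cf79 and I-2-6a; cell sketch
`sketch-ComponentThreadsT1d-g2.lean` f98eed99a9731357, §§1–4 below verbatim up to the namespace), LANDED by
`res-dim4-p-6` g2 (port offer 2026-08-28 18:52Z).  Part 2 (`PurelyInseparableDim4ComponentThreadsExact.lean`)
carries §5 (idea-2's LEMMA B2) and §6 (p-6: the EXACT form of T1, every field, every `q`).
Critics: crit-1 V-A-24 (T1 / B2 hand ✓, 0 violations on 505,036 + 170,424 own replays), crit-2 V-B-28.

Objects.  A state is the frame's `State K = CentreBlowup.CState (Fin 4) K`; a coordinate centre is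
`C_S = V(z, x_S)`, `S : Finset (Fin 4)`; one blow-up edge at the point `b` of the `x_j`-chart is the tree's
`CentreBlowup.step q S j b s` (chart transform, translation by `b`, cleaning).  The THREAD DATUM of `F` along
`C_S` is `suppS S F` = the set of `S`-CLASSES (`classOf S d` = the restriction of an exponent `d` to `S`,
indexed by `Fin S.card`) of the monomials of `F`; a point `b` with `b|_S = 0` is a point of the new exceptional
divisor that does not move in the fibre (it may move ALONG the centre).

* §1–§4 (idea-2) **`suppS_step_subset`** — LEMMA T1, SUBSET form, hypothesis-free: the thread datum of the
  child at `b|_S = 0` lies in the `IsoSpine.spineMove`-image of the parent's (cleaning deletes; translation off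
  `S` creates no class, `exists_classEq_of_mem_support_translate`; the chart law IS `spineMove` on classes,
  `classOf_chartExponent`); **`noTransversalThread`** / **`noTransversalTail`** — NO infinite run of blow-ups
  in ONE coordinate centre `C_S` that is a COMPONENT (`IsComponent`: permissible, no `C_{S∖k}` permissible) at
  every step, at points with `b|_S = 0` — every field, every `q`, every `|S|`; engine = the tree theorem
  `IsoSpine.noPointOnlySpineBranch S.card q` (idea-3 / p-10: no infinite legal point-only spine branch,
  sub-supports allowed — which is why the subset form suffices).  `|S| = 1` is the DIV clock's shape
  (`DivClock.no_divisor_branch`), `|S| = 4`, `b = 0` is ISO-SPINE-PO.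
* `TransversalDictionary p e` — LEMMA T1 in EXACT form as typed by idea-2 (equality of thread data for a clean
  permissible parent); proved for all `p, e` in part 2 (`ComponentThreads.transversalDictionary`).

Scope (honest): statements about OUR coordinate-centre frame; the `:fib` steps (`b|_S ≠ 0`, p-9's
straightening regime) and FINITE-SWITCHES are NOT touched — they are the open part of CARD I-2-6 §T3.
[OURS · counted 0 · elementary kernel bookkeeping; AI kernel work, weaker than expert review.]  NOTHING here is
a statement about resolution of singularities; resolution in dimension `≥ 4` / characteristic `p > 0` is NOT
proved by anything in this file.  bears_on: LADDER-RESOLUTION:D157-DOOR2 (res-dim4-pi · F4-C component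
threads).  Host item (DR-157-C): `stmt-ResolutionOfSingularities-16155` (`MarkedTransfer.HypersurfaceOrderReduction`),
helper.
-/

noncomputable section

set_option linter.dupNamespace false -- mandated namespace of this single-conjunct summit

open MvPolynomial Finset
open scoped BigOperators

namespace Summit.ResolutionOfSingularities.ResolutionOfSingularities.Theorems.PIDim4

namespace ComponentThreads

open Literature.AlgebraicGeometry.Resolution
open Literature.AlgebraicGeometry.Resolution.Hauser2010
open Summit.ResolutionOfSingularities.ResolutionOfSingularities.Theorems.PIDim4.IsoSpine

/-! ## 1. Thread data -/

/-- the `S`-CLASS of an exponent vector: its restriction to `S`, indexed by `Fin S.card` through the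
increasing enumeration `S.orderEmbOfFin rfl`. OURS (res-dim4-idea-2, CARD I-2-6). [folklore] -/
def classOf (S : Finset (Fin 4)) (d : Fin 4 →₀ ℕ) : Fin S.card → ℕ :=
  fun i => d (S.orderEmbOfFin rfl i)

/-- the THREAD DATUM `supp_S F`: the set of `S`-classes of the monomials of `F`. OURS (res-dim4-idea-2,
CARD I-2-6). [folklore] -/
def suppS {K : Type} [Field K] (S : Finset (Fin 4)) (F : MvPolynomial (Fin 4) K) :
    Finset (Fin S.card → ℕ) :=
  F.support.image (classOf S)

/-- the position of `j ∈ S` in the increasing enumeration of `S`. OURS. [folklore] -/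
noncomputable def idxS (S : Finset (Fin 4)) (j : Fin 4) (hj : j ∈ S) : Fin S.card :=
  (S.orderIsoOfFin rfl).symm ⟨j, hj⟩

/-- `C_S = V(x_i : i ∈ S)` is a COMPONENT of the `q`-fold locus among coordinate subspaces: permissible,
and no `C_{S \ {k}} ⊋ C_S` (`k ∈ S`) is permissible (by monotonicity of `ordAlong` in `S` this is
maximality among all coordinate subspaces; IN SCOPE these are the components through the origin,
`ScopeComponents.span_X_mem_minimalPrimes_of_minimal`). OURS (res-dim4-idea-2, CARD I-2-6).
[cite: HauserPerlega2019PRIMS, §2 (permissible blowups, `ord_P`)] -/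
def IsComponent {K : Type} [Field K] (q : ℕ) (S : Finset (Fin 4)) (F : MvPolynomial (Fin 4) K) :
    Prop :=
  IsPermissibleCentre q S F ∧ ∀ k ∈ S, ¬ ((q : ℕ∞) ≤ CentreBlowup.ordAlong (S.erase k) F)

/-- **LEMMA T1 (transversal dictionary), exact form**, `q = p^e`: for a CLEAN parent
(`deletePthPowers q F = F`), a permissible coordinate centre `C_S`, a chart `j ∈ S` and a closed point
`b` of the chart with `b|_S = 0`, the thread datum of the child `CentreBlowup.step q S j b s` is the
image of the parent's under the point-blow-up exponent law `spineMove q j` of the `|S|`-dimensional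
spine game.  Typed by res-dim4-idea-2; PROVED for all `p, e` in part 2
(`PurelyInseparableDim4ComponentThreadsExact.lean`, `transversalDictionary`), in fact without the `CharP`
hypothesis (`suppS_step_eq`); the subset half is `suppS_step_subset` below. OURS. [folklore] -/
def TransversalDictionary (p e : ℕ) : Prop :=
  ∀ (K : Type) [Field K] [CharP K p] [DecidableEq K] (S : Finset (Fin 4)) (j : Fin 4) (hj : j ∈ S)
    (b : Fin 4 → K), (∀ i ∈ S, b i = 0) → ∀ s : State K, deletePthPowers (p ^ e) s.F = s.F →
      ((p ^ e : ℕ) : ℕ∞) ≤ CentreBlowup.ordAlong S s.F →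
      suppS S (CentreBlowup.step (p ^ e) S j b s).F =
        (suppS S s.F).image (spineMove (p ^ e) (idxS S j hj))

/-- **No infinite TRANSVERSAL THREAD**: no infinite run of blow-ups with ONE coordinate centre `C_S`
that is a component at every step, at points with `b|_S = 0`. OURS (res-dim4-idea-2, CARD I-2-6 §T3,
the `:t0/:ctr` half). [folklore] -/
def NoTransversalThread (q : ℕ) : Prop :=
  ∀ (K : Type) [Field K] [DecidableEq K] (S : Finset (Fin 4)),
    ¬ ∃ (c : ℕ → State K) (j : ℕ → Fin 4) (b : ℕ → Fin 4 → K), ∀ k,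
        j k ∈ S ∧ (∀ i ∈ S, b k i = 0) ∧ IsComponent q S (c k).F ∧
        c (k + 1) = CentreBlowup.step q S (j k) (b k) (c k)

/-! ## 2. Class arithmetic -/

/-- total `S`-degree of a class = `degIn S`. OURS. [folklore] -/
theorem sum_classOf (S : Finset (Fin 4)) (d : Fin 4 →₀ ℕ) :
    ∑ i, classOf S d i = CentreBlowup.degIn S d := by
  unfold classOf CentreBlowup.degIn
  have h1 : ∑ i : Fin S.card, d (S.orderEmbOfFin rfl i) = ∑ x : S, d x := by
    refine Fintype.sum_equiv (S.orderIsoOfFin rfl).toEquiv _ _ (fun i => ?_)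
    simp [Finset.coe_orderIsoOfFin_apply]
  rw [h1, Finset.sum_coe_sort]

/-- the enumeration at the position of `k` is `k`. OURS. [folklore] -/
theorem orderEmbOfFin_idxS (S : Finset (Fin 4)) (k : Fin 4) (hk : k ∈ S) :
    (S.orderEmbOfFin rfl (idxS S k hk) : Fin 4) = k := by
  unfold idxS
  rw [← Finset.coe_orderIsoOfFin_apply, OrderIso.apply_symm_apply]

/-- the enumeration hits `k` exactly at `idxS S k hk`. OURS. [folklore] -/
theorem orderEmbOfFin_eq_iff (S : Finset (Fin 4)) (k : Fin 4) (hk : k ∈ S) (i : Fin S.card) :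
    (S.orderEmbOfFin rfl i : Fin 4) = k ↔ i = idxS S k hk := by
  constructor
  · intro h
    apply (S.orderEmbOfFin rfl).injective
    rw [h, orderEmbOfFin_idxS]
  · rintro rfl
    exact orderEmbOfFin_idxS S k hk

/-- the class coordinate at `idxS S k hk` is `d k`. OURS. [folklore] -/
theorem classOf_idxS (S : Finset (Fin 4)) (d : Fin 4 →₀ ℕ) (k : Fin 4) (hk : k ∈ S) :
    classOf S d (idxS S k hk) = d k := by
  unfold classOf
  rw [orderEmbOfFin_idxS]

/-- the chart exponent law IS `spineMove` on classes. OURS.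
[cite: HauserPerlega2019PRIMS, §2 (the blowup in the x₁-chart)] -/
theorem classOf_chartExponent (q : ℕ) (S : Finset (Fin 4)) (j : Fin 4) (hj : j ∈ S)
    (e : Fin 4 →₀ ℕ) :
    classOf S (CentreBlowup.chartExponent q S j e) = spineMove q (idxS S j hj) (classOf S e) := by
  funext i
  unfold spineMove
  rw [sum_classOf]
  unfold classOf CentreBlowup.chartExponent
  rw [Finsupp.update_apply, Function.update_apply]
  by_cases h : i = idxS S j hj
  · rw [if_pos ((orderEmbOfFin_eq_iff S j hj i).mpr h), if_pos h]
  · rw [if_neg (fun h' => h ((orderEmbOfFin_eq_iff S j hj i).mp h')), if_neg h]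

/-! ## 3. Translation off the fibre does not create classes -/

section Translate

variable {K : Type} [Field K]

/-- every monomial of `translate b G`, `b|_S = 0`, has the `S`-class of some monomial of `G`. OURS
(res-dim4-idea-2). [folklore] -/
theorem exists_classEq_of_mem_support_translate (S : Finset (Fin 4)) (b : Fin 4 → K)
    (hb : ∀ i ∈ S, b i = 0) (G : MvPolynomial (Fin 4) K) {d' : Fin 4 →₀ ℕ}
    (hd' : d' ∈ (PointBlowup.translate b G).support) :
    ∃ d ∈ G.support, ∀ i ∈ S, d' i = d i := by
  classical
  -- distribute the translation over the monomials of `G`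
  have hsum : PointBlowup.translate b G =
      ∑ d ∈ G.support, PointBlowup.translate b (monomial d (coeff d G)) := by
    unfold PointBlowup.translate
    rw [← map_sum]
    congr 1
    exact G.as_sum
  rw [hsum] at hd'
  obtain ⟨d, hd, hmem⟩ := Finset.mem_biUnion.mp (MvPolynomial.support_sum hd')
  refine ⟨d, hd, ?_⟩
  -- split `x^d = x^{d_S} · x^{d_T}` into its `S`-part and its off-`S` part
  set dS : Fin 4 →₀ ℕ := d.filter (fun i => i ∈ S) with hdS
  set dT : Fin 4 →₀ ℕ := d.filter (fun i => ¬ i ∈ S) with hdT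
  have hsplit : monomial d (coeff d G) = monomial dS (coeff d G) * monomial dT (1 : K) := by
    rw [monomial_mul, mul_one, Finsupp.filter_add_filter_not]
  -- the `S`-part is fixed by the translation
  have hfixS : PointBlowup.translate b (monomial dS (coeff d G)) = monomial dS (coeff d G) := by
    unfold PointBlowup.translate
    rw [aeval_monomial, monomial_eq, MvPolynomial.algebraMap_eq]
    congr 1
    refine Finsupp.prod_congr (fun n hn => ?_)
    have hnS : n ∈ S := by
      rw [hdS, Finsupp.support_filter, Finset.mem_filter] at hn
      exact hn.2
    rw [hb n hnS, map_zero, add_zero]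
  -- the off-`S` part stays a polynomial in the off-`S` variables
  set R : MvPolynomial (Fin 4) K := PointBlowup.translate b (monomial dT (1 : K)) with hR
  have hRsupp : R ∈ MvPolynomial.supported K ((↑S : Set (Fin 4))ᶜ) := by
    rw [hR]
    unfold PointBlowup.translate
    rw [aeval_monomial, map_one, one_mul]
    refine Subalgebra.prod_mem _ (fun n hn => ?_)
    have hnS : n ∉ S := by
      rw [hdT, Finsupp.support_filter, Finset.mem_filter] at hn
      exact hn.2
    refine Subalgebra.pow_mem _ (Subalgebra.add_mem _ ?_ ?_) _
    · exact (MvPolynomial.X_mem_supported).mpr (by simpa using hnS)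
    · rw [← MvPolynomial.algebraMap_eq]
      exact Subalgebra.algebraMap_mem _ _
  have hRvars : ∀ m ∈ R.support, ∀ i ∈ S, m i = 0 := by
    intro m hm i hi
    by_contra hne
    have hiv : i ∈ R.vars :=
      (MvPolynomial.mem_vars_iff_mem_support i).mpr ⟨m, hm, Finsupp.mem_support_iff.mpr hne⟩
    have := (MvPolynomial.mem_supported.mp hRsupp) hiv
    simp at this
    exact this hi
  -- read off the class of `d'`
  have hprod : PointBlowup.translate b (monomial d (coeff d G)) = monomial dS (coeff d G) * R := by
    rw [hsplit]
    unfold PointBlowup.translate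
    rw [map_mul]
    change PointBlowup.translate b (monomial dS (coeff d G)) * R = _
    rw [hfixS]
  rw [hprod, MvPolynomial.mem_support_iff, coeff_monomial_mul'] at hmem
  split_ifs at hmem with hle
  · have hm : d' - dS ∈ R.support := by
      rw [MvPolynomial.mem_support_iff]
      intro h0
      rw [h0, mul_zero] at hmem
      exact hmem rfl
    intro i hi
    have h1 := hRvars _ hm i hi
    rw [Finsupp.tsub_apply] at h1
    have h2 : dS i ≤ d' i := hle i
    have h3 : dS i = d i := by rw [hdS, Finsupp.filter_apply_pos _ _ hi]
    omega
  · exact absurd rfl hmem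

end Translate

/-! ## 4. The subset form of T1 and the transversal-thread theorem -/

section Step

variable {K : Type} [Field K] [DecidableEq K]

/-- **LEMMA T1, subset form (every field, every `q`)**: the thread datum of the child at a point with
`b|_S = 0` lies in the `spineMove`-image of the parent's — cleaning deletes, translation off the fibre
keeps classes (`exists_classEq_of_mem_support_translate`), the chart transform moves classes by
`spineMove` (`classOf_chartExponent`). OURS (res-dim4-idea-2, CARD I-2-6 T1). [folklore] -/
theorem suppS_step_subset (q : ℕ) (S : Finset (Fin 4)) (j : Fin 4) (hj : j ∈ S) (b : Fin 4 → K)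
    (hb : ∀ i ∈ S, b i = 0) (s : State K) :
    suppS S (CentreBlowup.step q S j b s).F ⊆ (suppS S s.F).image (spineMove q (idxS S j hj)) := by
  classical
  intro a ha
  obtain ⟨E, hE, rfl⟩ := Finset.mem_image.mp ha
  change E ∈ (deletePthPowers q (PointBlowup.translate b
    (CentreBlowup.chartTransform q S j s.F))).support at hE
  rw [MvPolynomial.mem_support_iff, coeff_deletePthPowers] at hE
  have hE' : E ∈ (PointBlowup.translate b (CentreBlowup.chartTransform q S j s.F)).support := by
    rw [MvPolynomial.mem_support_iff]
    intro h0
    rw [h0, ite_self] at hE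
    exact hE rfl
  obtain ⟨d, hd, hcls⟩ := exists_classEq_of_mem_support_translate S b hb _ hE'
  obtain ⟨e, he, rfl⟩ := Perm2Bound.exists_of_mem_support_chartTransform q S j s.F hd
  refine Finset.mem_image.mpr ⟨classOf S e, Finset.mem_image.mpr ⟨e, he, rfl⟩, ?_⟩
  rw [← classOf_chartExponent q S j hj e]
  funext i
  exact (hcls _ (Finset.orderEmbOfFin_mem S rfl i)).symm

omit [DecidableEq K] in
/-- Legal: under permissibility of `C_S` every class has total degree `≥ q`. OURS (res-dim4-idea-2). [folklore] -/
theorem legal_suppS {q : ℕ} {S : Finset (Fin 4)} {F : MvPolynomial (Fin 4) K}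
    (h : (q : ℕ∞) ≤ CentreBlowup.ordAlong S F) : Legal q (suppS S F) := by
  intro m hm
  obtain ⟨d, hd, rfl⟩ := Finset.mem_image.mp hm
  unfold CentreBlowup.ordAlong at h
  have := (Finset.le_inf_iff.mp h) d hd
  rw [sum_classOf]
  exact_mod_cast this

omit [DecidableEq K] in
/-- PointOnly: if no `C_{S∖{k}}` is permissible, every axis of the `|S|`-game has a near class. OURS
(res-dim4-idea-2). [folklore] -/
theorem pointOnly_suppS {q : ℕ} {S : Finset (Fin 4)} {F : MvPolynomial (Fin 4) K}
    (h : ∀ k ∈ S, ¬ ((q : ℕ∞) ≤ CentreBlowup.ordAlong (S.erase k) F)) :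
    PointOnly q (suppS S F) := by
  intro k
  set k' : Fin 4 := S.orderEmbOfFin rfl k with hk'
  have hkS : k' ∈ S := Finset.orderEmbOfFin_mem S rfl k
  have hmax := h k' hkS
  rw [not_le] at hmax
  unfold CentreBlowup.ordAlong at hmax
  obtain ⟨d, hd, hlt⟩ := Finset.inf_lt_iff.mp hmax
  refine ⟨classOf S d, Finset.mem_image.mpr ⟨d, hd, rfl⟩, ?_⟩
  have hsub : CentreBlowup.degIn (S.erase k') d + d k' = CentreBlowup.degIn S d := by
    unfold CentreBlowup.degIn
    rw [add_comm]
    exact Finset.add_sum_erase S (fun i => d i) hkS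
  have hlt' : CentreBlowup.degIn (S.erase k') d < q := by exact_mod_cast hlt
  have hck : classOf S d k = d k' := rfl
  rw [sum_classOf, hck]
  omega

/-- **TRANSVERSAL-THREAD FINITENESS** (every field, every `q`): no infinite run of blow-ups in ONE
coordinate centre that is a component at every step, at points with `b|_S = 0`.  From
`IsoSpine.noPointOnlySpineBranch S.card q` through `suppS_step_subset`. OURS (res-dim4-idea-2, CARD
I-2-6 §T3, `:t0/:ctr` half). [folklore] -/
theorem noTransversalThread (q : ℕ) : NoTransversalThread q := by
  intro K _ _ S hex
  obtain ⟨c, j, b, h⟩ := hex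
  apply IsoSpine.noPointOnlySpineBranch S.card q
  refine ⟨fun t => suppS S (c t).F, fun t => idxS S (j t) (h t).1, fun t => ⟨?_, ?_, ?_⟩⟩
  · exact legal_suppS (h t).2.2.1.1.2
  · exact pointOnly_suppS (h t).2.2.1.2
  · obtain ⟨hj, hb, hcomp, hstep⟩ := h t
    show suppS S (c (t + 1)).F ⊆ (suppS S (c t).F).image (spineMove q (idxS S (j t) hj))
    rw [hstep]
    exact suppS_step_subset q S (j t) hj (b t) hb (c t)

/-- **Tail form**: an infinite run of coordinate-centre blow-ups cannot be EVENTUALLY a transversal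
thread — from some time on one component centre `C_S` and points with `b|_S = 0`.  (So an infinite
branch of any component rule has infinitely many centre switches or infinitely many fibre moves.) OURS
(res-dim4-idea-2). [folklore] -/
theorem noTransversalTail (q : ℕ) (K : Type) [Field K] [DecidableEq K] (S : Finset (Fin 4))
    (c : ℕ → State K) (j : ℕ → Fin 4) (b : ℕ → Fin 4 → K) (N : ℕ)
    (h : ∀ k, N ≤ k → j k ∈ S ∧ (∀ i ∈ S, b k i = 0) ∧ IsComponent q S (c k).F ∧
        c (k + 1) = CentreBlowup.step q S (j k) (b k) (c k)) : False := by
  apply noTransversalThread q K S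
  refine ⟨fun k => c (N + k), fun k => j (N + k), fun k => b (N + k), fun k => ?_⟩
  obtain ⟨hj, hb, hcomp, hstep⟩ := h (N + k) (Nat.le_add_right N k)
  refine ⟨hj, hb, hcomp, ?_⟩
  show c (N + (k + 1)) = _
  rw [← Nat.add_assoc]
  exact hstep

end Step

end ComponentThreads

end Summit.ResolutionOfSingularities.ResolutionOfSingularities.Theorems.PIDim4

end
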